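import Summits.AtomisticToContinuum.FouriersLaw.Theses.PhononMeanFreePath
import Literature.Barriers.AtomisticToContinuum.LowTemperatureWeakAnharmonicity

/-!
# IncoherentChannel — the amplitude-scaling conjugacy at kernel level and the unit-temperature normal form (negative-side support)

Support lemmas for crux `PhononMeanFreePath.IncoherentChannel` (item stmt-AtomisticToContinuum-11811)
from the standing disprover's work file `Cruxes/IncoherentChannel/Disproof.lean` §4, all sorry-free,
no new definitions (the crux's integrands are written out in full).

The tree proves the amplitude scaling `(q,p) ↦ (sq,sp)`, `(lam,β; T_L,T_R) ↦ (lam s², β s²; T_L/s², T_R/s²)`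
for the generator, weak steady states and currents (`Literature.Barriers.AtomisticToContinuum.
LowTemperatureWeakAnharmonicity`). Here it is pushed through the CONSTRUCTED objects the crux is typed
with:

* `chainFlow_smul` — the pathwise Langevin flow (uniqueness of the integral equation (IE));
* `solMap_smul`, `transitionKernel_smul`, `integral_transitionKernel_smul` — solution map and
  transition kernels (push-forward under `y ↦ s•y`);
* `integral_gibbsMeasure_smul` — Gibbs integrals (tilted Lebesgue measure; the Jacobian cancels);
* `rN_smul`, `CN_smul`, `cum_smul`, `seqA_smul` — `r_N ↦ s²r_N`, `C_N ↦ s⁴C_N`, and the crux sequence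
  `a_N = N(γ²/T²)∫(C_N - 2r_N²)` is EXACTLY invariant: `a_N(lam,β,s²T) = a_N(lam s²,β s²,T)`;
* `crux_at_iff_effective_couplings` (temperature enters only through `lam·T`, `β·T`) and
  `incoherentChannel_iff_unit_temperature`: the crux is equivalent to its `T = 1` slice.
-/

noncomputable section

open MeasureTheory Filter Topology Set
open scoped NNReal
open Literature.MathematicalPhysics.KineticTheory.HeatConduction
open Literature.Probability.Process
open Literature.Barriers.AtomisticToContinuum.HeatConduction (hamiltonian_smul partialQ_hamiltonian_scaled)
open Summit.AtomisticToContinuum.FouriersLaw.Theses.PhononMeanFreePath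

namespace Summit.AtomisticToContinuum.FouriersLaw.Theorems.IncoherentChannel.Negative.UnitTemperature

/-- The crux is `AT` at every admissible parameter point (definitional). -/
theorem crux_iff : IncoherentChannel ↔
    ∀ ω₂ lam β γ : ℝ, 0 < ω₂ → 0 < lam → 0 < β → 0 < γ → ∀ T : ℝ, 0 < T → (∃ κ : ℝ, 0 < κ ∧ Filter.Tendsto (fun N : ℕ => ((N : ℝ) * (γ ^ 2 / T ^ 2) * ∫ t in Set.Ioi (0 : ℝ), (((∫ z, (z.2 0) ^ 2 * (∫ y, (y.2 (Fin.last N)) ^ 2 ∂((pinnedChain ω₂ lam β γ).transitionKernel (N + 1) T T (Real.toNNReal t) z)) ∂((pinnedChain ω₂ lam β γ).gibbsMeasure (N + 1) T)) - (∫ z, (z.2 0) ^ 2 ∂((pinnedChain ω₂ lam β γ).gibbsMeasure (N + 1) T)) * (∫ z, (∫ y, (y.2 (Fin.last N)) ^ 2 ∂((pinnedChain ω₂ lam β γ).transitionKernel (N + 1) T T (Real.toNNReal t) z)) ∂((pinnedChain ω₂ lam β γ).gibbsMeasure (N + 1) T))) - 2 * (∫ z, z.2 0 * (∫ y, y.2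 (Fin.last N) ∂((pinnedChain ω₂ lam β γ).transitionKernel (N + 1) T T (Real.toNNReal t) z)) ∂((pinnedChain ω₂ lam β γ).gibbsMeasure (N + 1) T)) ^ 2))) Filter.atTop (nhds κ)) :=
  Iff.rfl

section Scaling

variable {ω₂ lam β γ : ℝ} (hω : 0 < ω₂) (hl : 0 ≤ lam) (hβ : 0 ≤ β) (hγ : 0 ≤ γ) (N : ℕ)

/-- **Drift scaling**: `Y^{lam,β}(s•x) = s • Y^{lam s²,β s²}(x)` (`s ≠ 0`). [folklore] -/
theorem drift_smul {s : ℝ} (hs : s ≠ 0) (x : PhaseSpace N) :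
    (pinnedChain ω₂ lam β γ).drift N (s • x) =
      s • (pinnedChain ω₂ (lam * s ^ 2) (β * s ^ 2) γ).drift N x := by
  have hQ : ∀ i : Fin N, partialQ i ((pinnedChain ω₂ lam β γ).hamiltonian N) (s • x) =
      s * partialQ i ((pinnedChain ω₂ (lam * s ^ 2) (β * s ^ 2) γ).hamiltonian N) x := by
    intro i
    rw [partialQ_hamiltonian_scaled ω₂ lam β γ hs i x]
    field_simp
  have hγ1 : (pinnedChain ω₂ lam β γ).γ = γ := rfl
  have hγ2 : (pinnedChain ω₂ (lam * s ^ 2) (β * s ^ 2) γ).γ = γ := rfl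
  ext i
  · simp [OscillatorChain.drift]
  · simp only [OscillatorChain.drift, Prod.smul_snd, Pi.smul_apply, smul_eq_mul, hγ1, hγ2]
    rw [hQ i]
    ring

/-- The forcing path scales: `forcing (s•x) (s•η) = s • forcing x η`. [folklore] -/
theorem forcing_smul (s : ℝ) (x : PhaseSpace N) (η : ℝ → Fin N → ℝ) (r : ℝ) :
    OscillatorChain.forcing (s • x) (s • η) r = s • OscillatorChain.forcing x η r := by
  simp only [OscillatorChain.forcing, smul_add, Prod.smul_mk, smul_zero, Pi.smul_apply]

include hω hl hβ hγ in
/-- **Flow conjugacy** (pathwise amplitude scaling): for a continuous noise path `η` and `s ≠ 0`,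
`Φ^{lam,β}_t(s•x, s•η) = s • Φ^{lam s²,β s²}_t(x, η)` — the scaled flow solves the scaled integral
equation (`drift_smul`), and (IE) has a unique continuous solution. [folklore] -/
theorem chainFlow_smul {s : ℝ} (hs : s ≠ 0) (x : PhaseSpace N) {η : ℝ → Fin N → ℝ}
    (hη : Continuous η) (t : ℝ) :
    (pinnedChain ω₂ lam β γ).chainFlow N (s • x) (s • η) t =
      s • (pinnedChain ω₂ (lam * s ^ 2) (β * s ^ 2) γ).chainFlow N x η t := by
  have hl' : 0 ≤ lam * s ^ 2 := by positivity
  have hβ' : 0 ≤ β * s ^ 2 := by positivity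
  have hη' : Continuous (s • η) := hη.const_smul s
  rcases le_or_gt t 0 with ht | ht
  · rw [pinnedChain_chainFlow_of_nonpos ω₂ lam β γ N (s • x) hη' ht,
      pinnedChain_chainFlow_of_nonpos ω₂ _ _ γ N x hη ht]
    simp only [smul_add, Prod.smul_mk, smul_zero, Pi.smul_apply]
  · set z : ℝ → PhaseSpace N := fun r =>
      s • (pinnedChain ω₂ (lam * s ^ 2) (β * s ^ 2) γ).chainFlow N x η r with hz
    have hzc : Continuous z := (pinnedChain_continuous_chainFlow hω hl' hβ' hγ N x hη).const_smul s
    have hsol : Literature.Analysis.ODE.IsIntegralSolutionOn ((pinnedChain ω₂ lam β γ).drift N)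
        (OscillatorChain.forcing (s • x) (s • η)) z t := by
      intro r hr
      have h' := pinnedChain_isIntegralSolutionOn_chainFlow hω hl' hβ' hγ N x hη t r hr
      simp only [hz]
      rw [h', smul_add, forcing_smul, ← intervalIntegral.integral_smul]
      congr 1
      congr 1
      funext τ
      exact (drift_smul N hs _).symm
    exact (pinnedChain_eqOn_chainFlow hω hl hβ hγ N (s • x) hη' hsol hzc ⟨ht.le, le_rfl⟩).symm

/-- Noise amplitudes enter `chainNoise` linearly. [folklore] -/
theorem chainNoise_smul (s c_L c_R : ℝ) (w : WienerPair) :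
    chainNoise N (s * c_L) (s * c_R) w = s • chainNoise N c_L c_R w := by
  funext t i
  simp only [chainNoise, Pi.smul_apply, smul_eq_mul]
  split_ifs <;> ring

/-- `√(2γ·s²a) = s·√(2γa)` for `s ≥ 0` (both sides are the junk `0` when `γa < 0`). [folklore] -/
theorem sqrt_two_mul_mul_sq_mul (γ' : ℝ) {s : ℝ} (hs : 0 ≤ s) (a : ℝ) :
    Real.sqrt (2 * γ' * (s ^ 2 * a)) = s * Real.sqrt (2 * γ' * a) := by
  rw [show 2 * γ' * (s ^ 2 * a) = s ^ 2 * (2 * γ' * a) by ring, Real.sqrt_mul (sq_nonneg s),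
    Real.sqrt_sq hs]

include hω hl hβ hγ in
/-- **Solution-map conjugacy**: bath temperatures scale like energies (`T ↦ s²T`, amplitudes
`√(2γT) ↦ s√(2γT)`), so `Φ^{lam,β; s²T_L,s²T_R}_t(s•x, w) = s • Φ^{lam s²,β s²; T_L,T_R}_t(x, w)` for
every pair of raw driving paths `w` and `s > 0`. [folklore] -/
theorem solMap_smul {s : ℝ} (hs : 0 < s) (T_L T_R t : ℝ) (x : PhaseSpace N) (w : WienerPair) :
    (pinnedChain ω₂ lam β γ).solMap N (s ^ 2 * T_L) (s ^ 2 * T_R) t (s • x) w =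
      s • (pinnedChain ω₂ (lam * s ^ 2) (β * s ^ 2) γ).solMap N T_L T_R t x w := by
  unfold OscillatorChain.solMap
  have hγ1 : (pinnedChain ω₂ lam β γ).γ = γ := rfl
  have hγ2 : (pinnedChain ω₂ (lam * s ^ 2) (β * s ^ 2) γ).γ = γ := rfl
  rw [hγ1, hγ2, sqrt_two_mul_mul_sq_mul γ hs.le, sqrt_two_mul_mul_sq_mul γ hs.le, chainNoise_smul]
  exact chainFlow_smul hω hl hβ hγ N hs.ne' x (continuous_chainNoise _ _ w) t

include hω hl hβ hγ in
/-- **Transition-kernel conjugacy**: `P^{lam,β; s²T_L,s²T_R}_t(s•x, ·)` is the push-forward of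
`P^{lam s²,β s²; T_L,T_R}_t(x, ·)` under `y ↦ s•y` (`s > 0`). [folklore] -/
theorem transitionKernel_smul {s : ℝ} (hs : 0 < s) (T_L T_R : ℝ) (t : ℝ≥0) (x : PhaseSpace N) :
    (pinnedChain ω₂ lam β γ).transitionKernel N (s ^ 2 * T_L) (s ^ 2 * T_R) t (s • x) =
      ((pinnedChain ω₂ (lam * s ^ 2) (β * s ^ 2) γ).transitionKernel N T_L T_R t x).map
        (fun y => s • y) := by
  have hl' : 0 ≤ lam * s ^ 2 := by positivity
  have hβ' : 0 ≤ β * s ^ 2 := by positivity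
  rw [pinnedChain_transitionKernel_apply hω hl hβ hγ, pinnedChain_transitionKernel_apply hω hl' hβ' hγ,
    Measure.map_map (measurable_const_smul s)
      (pinnedChain_measurable_solMap_pairPath_right hω hl' hβ' hγ N T_L T_R t x)]
  congr 1
  funext ω
  simp only [Function.comp_apply]
  exact solMap_smul hω hl hβ hγ N hs T_L T_R t x (pairPath ω)

include hω hl hβ hγ in
/-- Integrals against the conjugated kernel (no measurability needed: `y ↦ s•y` is a measurable
automorphism). [folklore] -/
theorem integral_transitionKernel_smul {s : ℝ} (hs : 0 < s) (T_L T_R : ℝ) (t : ℝ≥0)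
    (x : PhaseSpace N) (h : PhaseSpace N → ℝ) :
    ∫ y, h y ∂((pinnedChain ω₂ lam β γ).transitionKernel N (s ^ 2 * T_L) (s ^ 2 * T_R) t (s • x)) =
      ∫ u, h (s • u) ∂((pinnedChain ω₂ (lam * s ^ 2) (β * s ^ 2) γ).transitionKernel N T_L T_R t x) := by
  rw [transitionKernel_smul hω hl hβ hγ N hs]
  exact integral_map_equiv (MeasurableEquiv.smul₀ s hs.ne') h

/-- **Gibbs-measure conjugacy** at the level of integrals: `∫ g dμ^{lam,β}_{s²T} =
∫ g(s•x) dμ^{lam s²,β s²}_T(x)` for every `g` and `s ≠ 0` (tilted Lebesgue measure; the Jacobian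
`|s|^{2N}` cancels between numerator and partition function; both sides are the junk `0` together
when `e^{-H/T}` is not integrable). [folklore] -/
theorem integral_gibbsMeasure_smul {s : ℝ} (hs : s ≠ 0) (T : ℝ) (g : PhaseSpace N → ℝ) :
    ∫ y, g y ∂((pinnedChain ω₂ lam β γ).gibbsMeasure N (s ^ 2 * T)) =
      ∫ x, g (s • x) ∂((pinnedChain ω₂ (lam * s ^ 2) (β * s ^ 2) γ).gibbsMeasure N T) := by
  set H := (pinnedChain ω₂ lam β γ).hamiltonian N with hHdef
  set H' := (pinnedChain ω₂ (lam * s ^ 2) (β * s ^ 2) γ).hamiltonian N with hH'def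
  simp only [OscillatorChain.gibbsMeasure_eq, integral_tilted]
  set c : ℝ := |(s ^ Module.finrank ℝ (PhaseSpace N))⁻¹| with hc
  have hc0 : c ≠ 0 := by
    rw [hc]
    exact abs_ne_zero.2 (inv_ne_zero (pow_ne_zero _ hs))
  haveI : (volume : Measure (PhaseSpace N)).IsAddHaarMeasure :=
    @Measure.prod.instIsAddHaarMeasure (Fin N → ℝ) _ _ _ (Fin N → ℝ) _ _ _ volume volume _ _ _ _ _ _
  have key : ∀ G : PhaseSpace N → ℝ, ∫ y, G y = c⁻¹ * ∫ x, G (s • x) := by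
    intro G
    have h1 : ∫ x, G (s • x) = c • ∫ y, G y := by
      rw [hc]
      exact Measure.integral_comp_smul volume G s
    rw [h1, smul_eq_mul, ← mul_assoc, inv_mul_cancel₀ hc0, one_mul]
  have hH : ∀ x : PhaseSpace N, -H (s • x) / (s ^ 2 * T) = -H' x / T := by
    intro x
    rw [hHdef, hH'def, hamiltonian_smul, neg_div, neg_div, mul_div_mul_left _ _ (pow_ne_zero 2 hs)]
  have hZ : (∫ y, Real.exp (-H y / (s ^ 2 * T))) = c⁻¹ * ∫ x, Real.exp (-H' x / T) := by
    have h := key (fun y => Real.exp (-H y / (s ^ 2 * T)))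
    simp only [hH] at h
    exact h
  have hmain := key (fun y => (Real.exp (-H y / (s ^ 2 * T)) / ∫ y, Real.exp (-H y / (s ^ 2 * T))) • g y)
  simp only [hH] at hmain
  rw [hmain, hZ]
  have hpt : ∀ x : PhaseSpace N,
      (Real.exp (-H' x / T) / (c⁻¹ * ∫ x, Real.exp (-H' x / T))) • g (s • x) =
        c * ((Real.exp (-H' x / T) / ∫ x, Real.exp (-H' x / T)) • g (s • x)) := by
    intro x
    simp only [smul_eq_mul]
    rw [div_mul_eq_div_div, div_inv_eq_mul]
    ring
  simp_rw [hpt]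
  rw [integral_const_mul, ← mul_assoc, inv_mul_cancel₀ hc0, one_mul]

include hω hl hβ hγ in
/-- `r_N` is an energy: `r_N(t; lam,β, s²T) = s² · r_N(t; lam s², β s², T)`. [folklore] -/
theorem rN_smul {s : ℝ} (hs : 0 < s) (T : ℝ) (n : ℕ) (t : ℝ) :
    (∫ z, z.2 0 * (∫ y, y.2 (Fin.last n) ∂((pinnedChain ω₂ lam β γ).transitionKernel (n + 1) (s ^ 2 * T) (s ^ 2 * T) (Real.toNNReal t) z)) ∂((pinnedChain ω₂ lam β γ).gibbsMeasure (n + 1) (s ^ 2 * T))) = s ^ 2 * (∫ z, z.2 0 * (∫ y, y.2 (Fin.last n) ∂((pinnedChain ω₂ (lam * s ^ 2) (β * s ^ 2) γ).transitionKernel (n + 1) T T (Real.toNNReal t) z)) ∂((pinnedChain ω₂ (lam * s ^ 2) (β * s ^ 2) γ).gibbsMeasure (n + 1) T)) := by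
  rw [integral_gibbsMeasure_smul (n + 1) hs.ne' T, ← integral_const_mul]
  refine integral_congr_ae (Eventually.of_forall fun x => ?_)
  simp only []
  rw [integral_transitionKernel_smul hω hl hβ hγ (n + 1) hs T T _ x]
  simp only [Prod.smul_snd, Pi.smul_apply, smul_eq_mul]
  rw [integral_const_mul]
  ring

include hω hl hβ hγ in
/-- `C_N` is an energy squared: `C_N(t; lam,β, s²T) = s⁴ · C_N(t; lam s², β s², T)`. [folklore] -/
theorem CN_smul {s : ℝ} (hs : 0 < s) (T : ℝ) (n : ℕ) (t : ℝ) :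
    ((∫ z, (z.2 0) ^ 2 * (∫ y, (y.2 (Fin.last n)) ^ 2 ∂((pinnedChain ω₂ lam β γ).transitionKernel (n + 1) (s ^ 2 * T) (s ^ 2 * T) (Real.toNNReal t) z)) ∂((pinnedChain ω₂ lam β γ).gibbsMeasure (n + 1) (s ^ 2 * T))) - (∫ z, (z.2 0) ^ 2 ∂((pinnedChain ω₂ lam β γ).gibbsMeasure (n + 1) (s ^ 2 * T))) * (∫ z, (∫ y, (y.2 (Fin.last n)) ^ 2 ∂((pinnedChain ω₂ lam β γ).transitionKernel (n + 1) (s ^ 2 * T) (s ^ 2 * T) (Real.toNNReal t) z)) ∂((pinnedChain ω₂ lam β γ).gibbsMeasure (n + 1) (s ^ 2 * T)))) = s ^ 4 * ((∫ z, (z.2 0) ^ 2 * (∫ y, (y.2 (Fin.last n)) ^ 2 ∂((pinnedChain ω₂ (lam * s ^ 2) (β * s ^ 2) γ).transitionKernel (n + 1) T T (Real.toNNReal t) z)) ∂((pinnedChain ω₂ (lam * s ^ 2) (β * s ^ 2) γ).gibbsMeasure (n + 1) T)) - (∫ z, (z.2 0) ^ 2 ∂((pinnedChain ω₂ (lam *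 s ^ 2) (β * s ^ 2) γ).gibbsMeasure (n + 1) T)) * (∫ z, (∫ y, (y.2 (Fin.last n)) ^ 2 ∂((pinnedChain ω₂ (lam * s ^ 2) (β * s ^ 2) γ).transitionKernel (n + 1) T T (Real.toNNReal t) z)) ∂((pinnedChain ω₂ (lam * s ^ 2) (β * s ^ 2) γ).gibbsMeasure (n + 1) T))) := by
  rw [integral_gibbsMeasure_smul (n + 1) hs.ne' T, integral_gibbsMeasure_smul (n + 1) hs.ne' T,
    integral_gibbsMeasure_smul (n + 1) hs.ne' T]
  have h1 : ∀ x : PhaseSpace (n + 1),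
      (s • x).2 0 ^ 2 * (∫ y, y.2 (Fin.last n) ^ 2
        ∂((pinnedChain ω₂ lam β γ).transitionKernel (n + 1) (s ^ 2 * T) (s ^ 2 * T) t.toNNReal (s • x))) =
      s ^ 4 * (x.2 0 ^ 2 * ∫ u, u.2 (Fin.last n) ^ 2
        ∂((pinnedChain ω₂ (lam * s ^ 2) (β * s ^ 2) γ).transitionKernel (n + 1) T T t.toNNReal x)) := by
    intro x
    rw [integral_transitionKernel_smul hω hl hβ hγ (n + 1) hs T T _ x]
    simp only [Prod.smul_snd, Pi.smul_apply, smul_eq_mul]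
    rw [show (fun u : PhaseSpace (n + 1) => (s * u.2 (Fin.last n)) ^ 2) =
        fun u => s ^ 2 * u.2 (Fin.last n) ^ 2 from funext fun u => by ring, integral_const_mul]
    ring
  have h2 : ∀ x : PhaseSpace (n + 1), (s • x).2 0 ^ 2 = s ^ 2 * x.2 0 ^ 2 := by
    intro x
    simp only [Prod.smul_snd, Pi.smul_apply, smul_eq_mul]
    ring
  have h3 : ∀ x : PhaseSpace (n + 1),
      (∫ y, y.2 (Fin.last n) ^ 2
        ∂((pinnedChain ω₂ lam β γ).transitionKernel (n + 1) (s ^ 2 * T) (s ^ 2 * T) t.toNNReal (s • x))) =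
      s ^ 2 * ∫ u, u.2 (Fin.last n) ^ 2
        ∂((pinnedChain ω₂ (lam * s ^ 2) (β * s ^ 2) γ).transitionKernel (n + 1) T T t.toNNReal x) := by
    intro x
    rw [integral_transitionKernel_smul hω hl hβ hγ (n + 1) hs T T _ x]
    simp only [Prod.smul_snd, Pi.smul_apply, smul_eq_mul]
    rw [show (fun u : PhaseSpace (n + 1) => (s * u.2 (Fin.last n)) ^ 2) =
        fun u => s ^ 2 * u.2 (Fin.last n) ^ 2 from funext fun u => by ring, integral_const_mul]
  simp_rw [h1, h2, h3]
  rw [integral_const_mul, integral_const_mul, integral_const_mul]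
  ring

include hω hl hβ hγ in
/-- The cumulant channel scales like `C_N`. [folklore] -/
theorem cum_smul {s : ℝ} (hs : 0 < s) (T : ℝ) (n : ℕ) (t : ℝ) :
    (((∫ z, (z.2 0) ^ 2 * (∫ y, (y.2 (Fin.last n)) ^ 2 ∂((pinnedChain ω₂ lam β γ).transitionKernel (n + 1) (s ^ 2 * T) (s ^ 2 * T) (Real.toNNReal t) z)) ∂((pinnedChain ω₂ lam β γ).gibbsMeasure (n + 1) (s ^ 2 * T))) - (∫ z, (z.2 0) ^ 2 ∂((pinnedChain ω₂ lam β γ).gibbsMeasure (n + 1) (s ^ 2 * T))) * (∫ z, (∫ y, (y.2 (Fin.last n)) ^ 2 ∂((pinnedChain ω₂ lam β γ).transitionKernel (n + 1) (s ^ 2 * T) (s ^ 2 * T) (Real.toNNReal t) z)) ∂((pinnedChain ω₂ lam β γ).gibbsMeasure (n + 1) (s ^ 2 * T)))) - 2 * (∫ z, z.2 0 * (∫ y, y.2 (Fin.last n) ∂((pinnedChain ω₂ lam β γ).transitionKernel (n + 1) (s ^ 2 * T) (s ^ 2 * T) (Real.toNNReal t) z)) ∂((pinnedChain ω₂ lam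 β γ).gibbsMeasure (n + 1) (s ^ 2 * T))) ^ 2) = s ^ 4 * (((∫ z, (z.2 0) ^ 2 * (∫ y, (y.2 (Fin.last n)) ^ 2 ∂((pinnedChain ω₂ (lam * s ^ 2) (β * s ^ 2) γ).transitionKernel (n + 1) T T (Real.toNNReal t) z)) ∂((pinnedChain ω₂ (lam * s ^ 2) (β * s ^ 2) γ).gibbsMeasure (n + 1) T)) - (∫ z, (z.2 0) ^ 2 ∂((pinnedChain ω₂ (lam * s ^ 2) (β * s ^ 2) γ).gibbsMeasure (n + 1) T)) * (∫ z, (∫ y, (y.2 (Fin.last n)) ^ 2 ∂((pinnedChain ω₂ (lam * s ^ 2) (β * s ^ 2) γ).transitionKernel (n + 1) T T (Real.toNNReal t) z)) ∂((pinnedChain ω₂ (lam * s ^ 2) (β * s ^ 2) γ).gibbsMeasure (n + 1) T))) - 2 * (∫ z, z.2 0 * (∫ y, y.2 (Fin.last n) ∂((pinnedChain ω₂ (lam * s ^ 2) (β * s ^ 2) γ).transitionKernel (n + 1) T T (Real.toNNReal t) z)) ∂((pinnedChain ω₂ (lam * s ^ 2) (β * s ^ 2) γ).gibbsMeasure (n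 + 1) T)) ^ 2) := by
  rw [CN_smul hω hl hβ hγ hs, rN_smul hω hl hβ hγ hs]
  ring

include hω hl hβ hγ in
/-- **The crux sequence is scale-INVARIANT**: `a_N(lam, β, s²T) = a_N(lam s², β s², T)` — the
prefactor `γ²/T²` exactly absorbs the `s⁴` of the cumulant channel (the finite-chain, Langevin-bath
form of the Aoki–Lukkarinen–Spohn amplitude scaling). [cite: AokiLukkarinenSpohn2006, §2 eqs. (2.8)-(2.13)] -/
theorem seqA_smul {s : ℝ} (hs : 0 < s) (T : ℝ) (n : ℕ) :
    ((n : ℝ) * (γ ^ 2 / (s ^ 2 * T) ^ 2) * ∫ t in Set.Ioi (0 : ℝ), (((∫ z, (z.2 0) ^ 2 * (∫ y, (y.2 (Fin.last n)) ^ 2 ∂((pinnedChain ω₂ lam β γ).transitionKernel (n + 1) (s ^ 2 * T) (s ^ 2 * T) (Real.toNNReal t) z)) ∂((pinnedChain ω₂ lam β γ).gibbsMeasure (n + 1) (s ^ 2 * T))) - (∫ z, (z.2 0) ^ 2 ∂((pinnedChain ω₂ lam β γ).gibbsMeasure (n + 1) (s ^ 2 * T))) * (∫ z, (∫ y, (y.2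 (Fin.last n)) ^ 2 ∂((pinnedChain ω₂ lam β γ).transitionKernel (n + 1) (s ^ 2 * T) (s ^ 2 * T) (Real.toNNReal t) z)) ∂((pinnedChain ω₂ lam β γ).gibbsMeasure (n + 1) (s ^ 2 * T)))) - 2 * (∫ z, z.2 0 * (∫ y, y.2 (Fin.last n) ∂((pinnedChain ω₂ lam β γ).transitionKernel (n + 1) (s ^ 2 * T) (s ^ 2 * T) (Real.toNNReal t) z)) ∂((pinnedChain ω₂ lam β γ).gibbsMeasure (n + 1) (s ^ 2 * T))) ^ 2)) = ((n : ℝ) * (γ ^ 2 / T ^ 2) * ∫ t in Set.Ioi (0 : ℝ), (((∫ z, (z.2 0) ^ 2 * (∫ y, (y.2 (Fin.last n)) ^ 2 ∂((pinnedChain ω₂ (lam * s ^ 2) (β * s ^ 2) γ).transitionKernel (n + 1) T T (Real.toNNReal t) z)) ∂((pinnedChain ω₂ (lam * s ^ 2) (β * s ^ 2) γ).gibbsMeasure (n + 1) T)) - (∫ z, (z.2 0) ^ 2 ∂((pinnedChain ω₂ (lam * s ^ 2) (β * s ^ 2) γ).gibbsMeasure (n + 1) T)) * (∫ z, (∫ y,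 (y.2 (Fin.last n)) ^ 2 ∂((pinnedChain ω₂ (lam * s ^ 2) (β * s ^ 2) γ).transitionKernel (n + 1) T T (Real.toNNReal t) z)) ∂((pinnedChain ω₂ (lam * s ^ 2) (β * s ^ 2) γ).gibbsMeasure (n + 1) T))) - 2 * (∫ z, z.2 0 * (∫ y, y.2 (Fin.last n) ∂((pinnedChain ω₂ (lam * s ^ 2) (β * s ^ 2) γ).transitionKernel (n + 1) T T (Real.toNNReal t) z)) ∂((pinnedChain ω₂ (lam * s ^ 2) (β * s ^ 2) γ).gibbsMeasure (n + 1) T)) ^ 2)) := by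
  simp_rw [cum_smul hω hl hβ hγ hs T n]
  rw [integral_const_mul]
  have hs4 : s ^ 4 ≠ 0 := pow_ne_zero 4 hs.ne'
  rw [show (s ^ 2 * T) ^ 2 = s ^ 4 * T ^ 2 by ring, div_mul_eq_div_div_swap]
  rw [show (n : ℝ) * (γ ^ 2 / T ^ 2 / s ^ 4) * (s ^ 4 * ∫ t in Ioi (0 : ℝ), (((∫ z, (z.2 0) ^ 2 * (∫ y, (y.2 (Fin.last n)) ^ 2 ∂((pinnedChain ω₂ (lam * s ^ 2) (β * s ^ 2) γ).transitionKernel (n + 1) T T (Real.toNNReal t) z)) ∂((pinnedChain ω₂ (lam * s ^ 2) (β * s ^ 2) γ).gibbsMeasure (n + 1) T)) - (∫ z, (z.2 0) ^ 2 ∂((pinnedChain ω₂ (lam * s ^ 2) (β * s ^ 2) γ).gibbsMeasure (n + 1) T)) * (∫ z, (∫ y, (y.2 (Fin.last n)) ^ 2 ∂((pinnedChain ω₂ (lam * s ^ 2) (β * s ^ 2) γ).transitionKernel (n + 1) T T (Real.toNNReal t) z)) ∂((pinnedChain ω₂ (lam * s ^ 2) (β * s ^ 2) γ).gibbsMeasure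 (n + 1) T))) - 2 * (∫ z, z.2 0 * (∫ y, y.2 (Fin.last n) ∂((pinnedChain ω₂ (lam * s ^ 2) (β * s ^ 2) γ).transitionKernel (n + 1) T T (Real.toNNReal t) z)) ∂((pinnedChain ω₂ (lam * s ^ 2) (β * s ^ 2) γ).gibbsMeasure (n + 1) T)) ^ 2)) =
      (n : ℝ) * (γ ^ 2 / T ^ 2 / s ^ 4 * s ^ 4) * ∫ t in Ioi (0 : ℝ), (((∫ z, (z.2 0) ^ 2 * (∫ y, (y.2 (Fin.last n)) ^ 2 ∂((pinnedChain ω₂ (lam * s ^ 2) (β * s ^ 2) γ).transitionKernel (n + 1) T T (Real.toNNReal t) z)) ∂((pinnedChain ω₂ (lam * s ^ 2) (β * s ^ 2) γ).gibbsMeasure (n + 1) T)) - (∫ z, (z.2 0) ^ 2 ∂((pinnedChain ω₂ (lam * s ^ 2) (β * s ^ 2) γ).gibbsMeasure (n + 1) T)) * (∫ z, (∫ y, (y.2 (Fin.last n)) ^ 2 ∂((pinnedChain ω₂ (lam * s ^ 2) (β * s ^ 2) γ).transitionKernel (n + 1) T T (Real.toNNReal t) z)) ∂((pinnedChain ω₂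 (lam * s ^ 2) (β * s ^ 2) γ).gibbsMeasure (n + 1) T))) - 2 * (∫ z, z.2 0 * (∫ y, y.2 (Fin.last n) ∂((pinnedChain ω₂ (lam * s ^ 2) (β * s ^ 2) γ).transitionKernel (n + 1) T T (Real.toNNReal t) z)) ∂((pinnedChain ω₂ (lam * s ^ 2) (β * s ^ 2) γ).gibbsMeasure (n + 1) T)) ^ 2) by ring,
    div_mul_cancel₀ _ hs4]

include hω hl hβ hγ in
/-- Hence the crux at one parameter point is scale-invariant. [folklore] -/
theorem crux_at_smul_iff {s : ℝ} (hs : 0 < s) (T : ℝ) :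
    (∃ κ : ℝ, 0 < κ ∧ Filter.Tendsto (fun N : ℕ => ((N : ℝ) * (γ ^ 2 / (s ^ 2 * T) ^ 2) * ∫ t in Set.Ioi (0 : ℝ), (((∫ z, (z.2 0) ^ 2 * (∫ y, (y.2 (Fin.last N)) ^ 2 ∂((pinnedChain ω₂ lam β γ).transitionKernel (N + 1) (s ^ 2 * T) (s ^ 2 * T) (Real.toNNReal t) z)) ∂((pinnedChain ω₂ lam β γ).gibbsMeasure (N + 1) (s ^ 2 * T))) - (∫ z, (z.2 0) ^ 2 ∂((pinnedChain ω₂ lam β γ).gibbsMeasure (N + 1) (s ^ 2 * T))) * (∫ z, (∫ y, (y.2 (Fin.last N)) ^ 2 ∂((pinnedChain ω₂ lam β γ).transitionKernel (N + 1) (s ^ 2 * T) (s ^ 2 * T) (Real.toNNReal t) z)) ∂((pinnedChain ω₂ lam β γ).gibbsMeasure (N + 1) (s ^ 2 * T)))) - 2 * (∫ z, z.2 0 * (∫ y, y.2 (Fin.last N) ∂((pinnedChain ω₂ lam β γ).transitionKernel (N + 1) (s ^ 2 * T) (s ^ 2 * T) (Real.toNNReal t) z)) ∂((pinnedChain ω₂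 lam β γ).gibbsMeasure (N + 1) (s ^ 2 * T))) ^ 2))) Filter.atTop (nhds κ)) ↔ (∃ κ : ℝ, 0 < κ ∧ Filter.Tendsto (fun N : ℕ => ((N : ℝ) * (γ ^ 2 / T ^ 2) * ∫ t in Set.Ioi (0 : ℝ), (((∫ z, (z.2 0) ^ 2 * (∫ y, (y.2 (Fin.last N)) ^ 2 ∂((pinnedChain ω₂ (lam * s ^ 2) (β * s ^ 2) γ).transitionKernel (N + 1) T T (Real.toNNReal t) z)) ∂((pinnedChain ω₂ (lam * s ^ 2) (β * s ^ 2) γ).gibbsMeasure (N + 1) T)) - (∫ z, (z.2 0) ^ 2 ∂((pinnedChain ω₂ (lam * s ^ 2) (β * s ^ 2) γ).gibbsMeasure (N + 1) T)) * (∫ z, (∫ y, (y.2 (Fin.last N)) ^ 2 ∂((pinnedChain ω₂ (lam * s ^ 2) (β * s ^ 2) γ).transitionKernel (N + 1) T T (Real.toNNReal t) z)) ∂((pinnedChain ω₂ (lam * s ^ 2) (β * s ^ 2) γ).gibbsMeasure (N + 1) T))) - 2 * (∫ z, z.2 0 * (∫ y, y.2 (Fin.last N) ∂((pinnedChain ω₂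 (lam * s ^ 2) (β * s ^ 2) γ).transitionKernel (N + 1) T T (Real.toNNReal t) z)) ∂((pinnedChain ω₂ (lam * s ^ 2) (β * s ^ 2) γ).gibbsMeasure (N + 1) T)) ^ 2))) Filter.atTop (nhds κ)) := by
  rw [show (fun n : ℕ => ((n : ℝ) * (γ ^ 2 / (s ^ 2 * T) ^ 2) * ∫ t in Set.Ioi (0 : ℝ), (((∫ z, (z.2 0) ^ 2 * (∫ y, (y.2 (Fin.last n)) ^ 2 ∂((pinnedChain ω₂ lam β γ).transitionKernel (n + 1) (s ^ 2 * T) (s ^ 2 * T) (Real.toNNReal t) z)) ∂((pinnedChain ω₂ lam β γ).gibbsMeasure (n + 1) (s ^ 2 * T))) - (∫ z, (z.2 0) ^ 2 ∂((pinnedChain ω₂ lam β γ).gibbsMeasure (n + 1) (s ^ 2 * T))) * (∫ z, (∫ y, (y.2 (Fin.last n)) ^ 2 ∂((pinnedChain ω₂ lam β γ).transitionKernel (n + 1) (s ^ 2 * T) (s ^ 2 * T) (Real.toNNReal t) z)) ∂((pinnedChain ω₂ lam β γ).gibbsMeasure (n + 1) (s ^ 2 * T)))) - 2 * (∫ z,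 z.2 0 * (∫ y, y.2 (Fin.last n) ∂((pinnedChain ω₂ lam β γ).transitionKernel (n + 1) (s ^ 2 * T) (s ^ 2 * T) (Real.toNNReal t) z)) ∂((pinnedChain ω₂ lam β γ).gibbsMeasure (n + 1) (s ^ 2 * T))) ^ 2))) =
      fun n : ℕ => ((n : ℝ) * (γ ^ 2 / T ^ 2) * ∫ t in Set.Ioi (0 : ℝ), (((∫ z, (z.2 0) ^ 2 * (∫ y, (y.2 (Fin.last n)) ^ 2 ∂((pinnedChain ω₂ (lam * s ^ 2) (β * s ^ 2) γ).transitionKernel (n + 1) T T (Real.toNNReal t) z)) ∂((pinnedChain ω₂ (lam * s ^ 2) (β * s ^ 2) γ).gibbsMeasure (n + 1) T)) - (∫ z, (z.2 0) ^ 2 ∂((pinnedChain ω₂ (lam * s ^ 2) (β * s ^ 2) γ).gibbsMeasure (n + 1) T)) * (∫ z, (∫ y, (y.2 (Fin.last n)) ^ 2 ∂((pinnedChain ω₂ (lam * s ^ 2) (β * s ^ 2) γ).transitionKernel (n + 1) T T (Real.toNNReal t) z)) ∂((pinnedChain ω₂ (lam * s ^ 2) (β * s ^ 2) γ).gibbsMeasure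 (n + 1) T))) - 2 * (∫ z, z.2 0 * (∫ y, y.2 (Fin.last n) ∂((pinnedChain ω₂ (lam * s ^ 2) (β * s ^ 2) γ).transitionKernel (n + 1) T T (Real.toNNReal t) z)) ∂((pinnedChain ω₂ (lam * s ^ 2) (β * s ^ 2) γ).gibbsMeasure (n + 1) T)) ^ 2)) from funext (seqA_smul hω hl hβ hγ hs T)]

/-- **Temperature enters only through the effective couplings `lam·T`, `β·T`**:
`At ω₂ lam β γ T ↔ At ω₂ (lam T) (β T) γ 1` for `T > 0`. [folklore] -/
theorem crux_at_iff_effective_couplings (hω : 0 < ω₂) (hl : 0 ≤ lam) (hβ : 0 ≤ β) (hγ : 0 ≤ γ) {T : ℝ}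
    (hT : 0 < T) : (∃ κ : ℝ, 0 < κ ∧ Filter.Tendsto (fun N : ℕ => ((N : ℝ) * (γ ^ 2 / T ^ 2) * ∫ t in Set.Ioi (0 : ℝ), (((∫ z, (z.2 0) ^ 2 * (∫ y, (y.2 (Fin.last N)) ^ 2 ∂((pinnedChain ω₂ lam β γ).transitionKernel (N + 1) T T (Real.toNNReal t) z)) ∂((pinnedChain ω₂ lam β γ).gibbsMeasure (N + 1) T)) - (∫ z, (z.2 0) ^ 2 ∂((pinnedChain ω₂ lam β γ).gibbsMeasure (N + 1) T)) * (∫ z, (∫ y, (y.2 (Fin.last N)) ^ 2 ∂((pinnedChain ω₂ lam β γ).transitionKernel (N + 1) T T (Real.toNNReal t) z)) ∂((pinnedChain ω₂ lam β γ).gibbsMeasure (N + 1) T))) - 2 * (∫ z, z.2 0 * (∫ y, y.2 (Fin.last N) ∂((pinnedChain ω₂ lam β γ).transitionKernel (N + 1) T T (Real.toNNReal t) z)) ∂((pinnedChain ω₂ lam β γ).gibbsMeasure (N + 1) T)) ^ 2))) Filter.atTop (nhds κ)) ↔ (∃ κ : ℝ, 0 < κ ∧ Filter.Tendsto (fun N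 : ℕ => ((N : ℝ) * (γ ^ 2 / 1 ^ 2) * ∫ t in Set.Ioi (0 : ℝ), (((∫ z, (z.2 0) ^ 2 * (∫ y, (y.2 (Fin.last N)) ^ 2 ∂((pinnedChain ω₂ (lam * T) (β * T) γ).transitionKernel (N + 1) 1 1 (Real.toNNReal t) z)) ∂((pinnedChain ω₂ (lam * T) (β * T) γ).gibbsMeasure (N + 1) 1)) - (∫ z, (z.2 0) ^ 2 ∂((pinnedChain ω₂ (lam * T) (β * T) γ).gibbsMeasure (N + 1) 1)) * (∫ z, (∫ y, (y.2 (Fin.last N)) ^ 2 ∂((pinnedChain ω₂ (lam * T) (β * T) γ).transitionKernel (N + 1) 1 1 (Real.toNNReal t) z)) ∂((pinnedChain ω₂ (lam * T) (β * T) γ).gibbsMeasure (N + 1) 1))) - 2 * (∫ z, z.2 0 * (∫ y, y.2 (Fin.last N) ∂((pinnedChain ω₂ (lam * T) (β * T) γ).transitionKernel (N + 1) 1 1 (Real.toNNReal t) z)) ∂((pinnedChain ω₂ (lam * T) (β * T) γ).gibbsMeasure (N + 1) 1)) ^ 2))) Filter.atTop (nhds κ)) := by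
  have hs : 0 < Real.sqrt T := Real.sqrt_pos.2 hT
  have hT' : Real.sqrt T ^ 2 = T := Real.sq_sqrt hT.le
  have h := crux_at_smul_iff (ω₂ := ω₂) (lam := lam) (β := β) (γ := γ) hω hl hβ hγ hs 1
  rwa [mul_one, hT'] at h

end Scaling

/-- **UNIT-TEMPERATURE NORMAL FORM OF THE CRUX.** `IncoherentChannel` is equivalent to its `T = 1`
slice over all positive `(ω₂, lam, β, γ)`. [cite: AokiLukkarinenSpohn2006, §2 eqs. (2.8)-(2.13)] -/
theorem incoherentChannel_iff_unit_temperature :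
    IncoherentChannel ↔ ∀ ω₂ lam β γ : ℝ, 0 < ω₂ → 0 < lam → 0 < β → 0 < γ → (∃ κ : ℝ, 0 < κ ∧ Filter.Tendsto (fun N : ℕ => ((N : ℝ) * (γ ^ 2 / 1 ^ 2) * ∫ t in Set.Ioi (0 : ℝ), (((∫ z, (z.2 0) ^ 2 * (∫ y, (y.2 (Fin.last N)) ^ 2 ∂((pinnedChain ω₂ lam β γ).transitionKernel (N + 1) 1 1 (Real.toNNReal t) z)) ∂((pinnedChain ω₂ lam β γ).gibbsMeasure (N + 1) 1)) - (∫ z, (z.2 0) ^ 2 ∂((pinnedChain ω₂ lam β γ).gibbsMeasure (N + 1) 1)) * (∫ z, (∫ y, (y.2 (Fin.last N)) ^ 2 ∂((pinnedChain ω₂ lam β γ).transitionKernel (N + 1) 1 1 (Real.toNNReal t) z)) ∂((pinnedChain ω₂ lam β γ).gibbsMeasure (N + 1) 1))) - 2 * (∫ z, z.2 0 * (∫ y, y.2 (Fin.last N) ∂((pinnedChain ω₂ lam β γ).transitionKernel (N + 1) 1 1 (Real.toNNReal t) z)) ∂((pinnedChain ω₂ lam β γ).gibbsMeasure (N + 1)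 1)) ^ 2))) Filter.atTop (nhds κ)) := by
  rw [crux_iff]
  constructor
  · intro h ω₂ lam β γ hω hl hβ hγ
    exact h ω₂ lam β γ hω hl hβ hγ 1 one_pos
  · intro h ω₂ lam β γ hω hl hβ hγ T hT
    rw [crux_at_iff_effective_couplings hω hl.le hβ.le hγ.le hT]
    exact h ω₂ (lam * T) (β * T) γ hω (by positivity) (by positivity) hγ

end Summit.AtomisticToContinuum.FouriersLaw.Theorems.IncoherentChannel.Negative.UnitTemperature
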